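import Summits.BirchSwinnertonDyer.Rank1Residual.X11b.YZCompositeAlgebra
import Summits.BirchSwinnertonDyer.Rank1Residual.X11b.RouteR1IMCEqCoreFrame
import Summits.BirchSwinnertonDyer.Rank1Residual.X11b.EmbeddingDatumPrime
import Literature.FieldTheory.AlgClosed.PadicAlgClEquivComplex
import Literature.NumberTheory.EllipticCurves.BurungaleCastellaSkinner2025.BDPMainConjecture
import Literature.NumberTheory.EllipticCurves.BurungaleCastellaSkinner2025.BDPMainConjectureAtTrivialCharacter
import Literature.NumberTheory.EllipticCurves.CastellaGrossiLeeSkinner2022.IMC2DivisibilityAndBDPValueFrame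
import Literature.NumberTheory.EllipticCurves.ModularityVersionApProofs
import Literature.NumberTheory.EllipticCurves.ModularParametrizationBCDTProofs
import Literature.NumberTheory.EllipticCurves.CuspFormLFunctionLevelConductorProofs
import HarnessLib

set_option autoImplicit false

/-!
# BCS 2025 Thm. 1.2.4 (b) ∘ CGLS 2022 Thm. 5.1.3 at the trivial character — the (sur) composite
# `BurungaleCastellaSkinner2025.thm124b_thm513_generator_constantCoeff` DERIVED from the two single-source
# frame facts and the tree's frame rigidity (no composite)

Cell `pub/bsd-print-x9` (D-0131 (2) PRINT tier), typer seat ty1 (gen 16); companion of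
`X11b/YZCompositeOfFrames.lean` (the (irr ∧ ¬sur) composites). THEOREMS ONLY (no definition, no named
fact, no `sorry`); nothing about any curve is asserted; PARTITION: 0 cells move. Not a leaf of THIS cell
((sur) is dead on X9/X10b) — recorded because the derivation is the same three lines of bookkeeping and the
composite (cell b2b-bsdres, referee verdict REF-6 "PUB[composite], LITERAL for consumers") feeds the W-ALL
(sur) rank-one rows (`RowC2.bsdp_of_bcsThm112b_of_thm331_of_thm124b`, `X11b.indexIdentityAt_of_heegner_of_thm124b_of_thm331`).

`thm124b_thm513_of_printFacts (h124b) (h513) (hC)`: the composite `Prop`, letter for letter, from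
`BurungaleCastellaSkinner2025.thm124b_exists_isBDPLFunction_isTorsion_charIdeal_eq` (Thm. 1.2.4 (b): a frame
`L₁` with `X_Gr` torsion and `ch_Λ(X_Gr)·R₀⟦T⟧ = (L₁)` along THE structure map),
`CastellaGrossiLeeSkinner2022.thm513_exists_isBDPLFunction_valueAtOne_disc` (Thm. 5.1.3 with (disc): a frame `L₄`
at `τ_* P` read through THE infinite place, `L₄(𝟙) = u·c_E⁻²(1 − a_p p⁻¹ + p⁻¹)²(log_{ω_E} τ_* P)²`) and
Carayol (`hC`, or the parametrisation fact `hpar` in `…_of_modularity`): embedding datum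
(`X11b.exists_datum_forall_mem_iff`), equal constant terms (`X11b.constantCoeff_eq_of_isBDPLFunction`), the
rank-free log symmetry `YZComposite.sq_padicLogOmega_map_eq_of_isHeegnerPoint` (Darmon 2004 Prop. 3.11) and
`X1.KellerYinHalves.exists_unit_constantCoeff_eq`. «beyond-print theorem»: no.

References: [BurungaleCastellaSkinner2025] Thm. 1.2.4 (b) (p. 3), proof of Cor. 1.3.1 (p. 4);
[CastellaGrossiLeeSkinner2022] Thm. 5.1.3; [Carayol1986]; [BCDTJAMS2001] Thm. A; [Darmon2004] Prop. 3.11.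
-/

noncomputable section

open scoped Classical

open PowerSeries WeierstrassCurve NumberField IsDedekindDomain Field
  Literature.NumberTheory.EllipticCurves Literature.NumberTheory.EllipticCurves.ModularForms
  Literature.NumberTheory.EllipticCurves.Rank1Residual
  Literature.NumberTheory.EllipticCurves.Castella2018
  Literature.NumberTheory.EllipticCurves.BurungaleCastellaSkinner2025
  Literature.NumberTheory.EllipticCurves.CastellaGrossiLeeSkinner2022
  Summit.BirchSwinnertonDyer.Rank1Residual
  Summit.BirchSwinnertonDyer.Rank1Residual.X11b.Halves
  Summit.BirchSwinnertonDyer.Rank1Residual.X1.KellerYinHalves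

namespace Summit.BirchSwinnertonDyer.Rank1Residual.X11b.YZComposite

/-- **BCS 2025 Thm. 1.2.4 (b) + CGLS 2022 Thm. 5.1.3 at the trivial character — the named fact
`BurungaleCastellaSkinner2025.thm124b_thm513_generator_constantCoeff` PROVED, letter for letter, from the
two single-source frame facts and Carayol's level fact.** Per datum: Carayol ⇒ `N = N_E`; `p ∈ v`, an
embedding datum `ι'` inducing `v`; frame `L₁` of Thm. 1.2.4 (b) (`X_Gr` torsion, `(F)·R₀⟦T⟧ = (L₁)` along
`toUnr`, `F` a generator of the principal `ch_Λ(X_Gr)`); frame `L₄` of Thm. 5.1.3 at `τ_* P` through THE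
infinite place; `[T⁰]L₄ = [T⁰]L₁` (`X11b.constantCoeff_eq_of_isBDPLFunction`); `(log τ_* P)² = (log P)²`
(Darmon Prop. 3.11, rank-free); `F(0) = u'·V`, `u' ∈ ℤ_pˣ` (`exists_unit_constantCoeff_eq`).
[cite: BurungaleCastellaSkinner2025, Thm. 1.2.4 (b) (§1.2, p. 3 of arXiv:2405.00270v2) and proof of Cor. 1.3.1 (p. 4)]
[cite: CastellaGrossiLeeSkinner2022, Thm. 5.1.3 (TeX `thmpadicGZ` L2463–L2471) with §2 (disc)]
[cite: Carayol1986] [cite: Darmon2004, Prop. 3.11] [cite: Castella2018, Thm. 3.1 (the frame)] -/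
theorem thm124b_thm513_of_printFacts
    (h124b : thm124b_exists_isBDPLFunction_isTorsion_charIdeal_eq)
    (h513 : thm513_exists_isBDPLFunction_valueAtOne_disc)
    (hC : ∀ (N : ℕ) [NeZero N], IsNewformOf.level_eq_conductorNorm (N := N)) :
    thm124b_thm513_generator_constantCoeff := by
  intro W _ _ p _ hp hord hsur K _ _ hK hHN hHp hodd h3 ι v vbar hv hvbar hne κ hκ γ _ N _ Dt H ιC P hP
  have hpp : p.Prime := Fact.out
  have hp2 : p ≠ 2 := by omega
  have hγ : κ.IsTopGenerator γ := Fact.out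
  have hNc : N = W.conductorNorm ℤ := hC N Dt.isNewformOf
  subst hNc
  have hpv : ((p : ℕ) : 𝓞 K) ∈ v.asIdeal := by
    rw [hv, show ι (((p : ℕ) : 𝓞 K) : K) = (p : ℚ_[p]) by simp]
    exact Padic.norm_p_lt_one
  have hsplit : ((Ideal.span {(p : ℤ)}).primesOver (𝓞 K)).ncard = 2 := hHp p hpp (dvd_refl p)
  have hgood : W.HasGoodReductionAtPrime p := hord.1
  have hpN : ¬ p ∣ W.conductorNorm ℤ := fun h ↦
    (W.dvd_conductorNorm_iff_not_hasGoodReductionAtPrime p).mp h hgood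
  obtain ⟨ι₀⟩ := PadicAlgCl.nonempty_ringEquiv_complex p
  obtain ⟨ι', -, hι'⟩ := X11b.exists_datum_forall_mem_iff p ι₀ hK hpv
  -- frame 1: Thm. 1.2.4 (b) — torsion and the integral equality
  obtain ⟨ΩK₁, Ωp₁, L₁, hΩK₁, hL₁, htors, heq⟩ :=
    h124b ι' W K v vbar κ γ Dt.isNewformOf hp hord hsur hK hHN hsplit hodd h3 hι' hvbar hne hκ
  have heq₁ := heq (toUnr p) (coe_toUnr p)
  -- frame 4: Thm. 5.1.3 at `τ_* P`
  obtain ⟨w₀⟩ := (inferInstance : Nonempty (InfinitePlace K))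
  obtain ⟨τ, hP'⟩ := exists_algHom_map_map_eq hK ιC w₀ Dt H hP
  obtain ⟨ΩK₄, Ωp₄, L₄, hΩK₄, hL₄, u, hu⟩ :=
    h513 ι' W K v κ γ Dt H w₀ ι (WeierstrassCurve.Affine.Point.map (W' := W) τ P) hp2 hpN hK hsplit
      hpv hι' hHN hodd h3 hκ hγ hP' hv
  have h41 : PowerSeries.constantCoeff L₄ = PowerSeries.constantCoeff L₁ :=
    X11b.constantCoeff_eq_of_isBDPLFunction hp2 hK hκ hγ hΩK₁ hΩK₄ (coe_units_ne_zero Ωp₁)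
      (coe_units_ne_zero Ωp₄) hL₁ hL₄
  -- a generator `F`; `(F') = (L₁)`
  obtain ⟨F, hF⟩ := (charIdeal_isPrincipal_holds p (Castella2018.AcSelmer.XAc (W.baseChange K) p κ vbar ∅ γ)).principal
  have hF' : Castella2018.AcSelmer.XAc.charIdeal (W.baseChange K) p κ vbar ∅ γ = Ideal.span {F} := hF
  have hspan : Ideal.span ({PowerSeries.map (toUnr p) F} : Set (UnrSeries p)) = Ideal.span {L₁} := by
    rw [← heq₁, hF', Ideal.map_span, Set.image_singleton]
  -- the value at `𝟙`, moved to `L₁` and to `P`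
  have hlog : padicLogOmega W p ι (WeierstrassCurve.Affine.Point.map (W' := W) τ P) ^ 2 =
      padicLogOmega W p ι P ^ 2 :=
    sq_padicLogOmega_map_eq_of_isHeegnerPoint W hK hHN ι ⟨Dt, H, ιC, hP⟩ τ
  rw [hlog] at hu
  have hval : L₁.HasValueAt 0 (((u : unrIntegers p) : ℂ_[p]) *
      algebraMap ℚ_[p] ℂ_[p] (((Dt.c : ℚ_[p])⁻¹) ^ 2 *
        (1 - (W.frobeniusTrace p : ℚ_[p]) * (p : ℚ_[p])⁻¹ + (p : ℚ_[p])⁻¹) ^ 2 *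
        padicLogOmega W p ι P ^ 2)) := by
    have h0 := UnrSeries.hasValueAt_zero L₁
    rw [← h41, ← UnrSeries.eq_constantCoeff_of_hasValueAt_zero hu] at h0
    exact h0
  obtain ⟨u', hu'⟩ := exists_unit_constantCoeff_eq hspan u hval
  refine ⟨htors, F, hF', u', ?_⟩
  rw [hu']
  unfold padicLogOmega
  ring

/-- The same with Carayol supplied by the parametrisation fact `nonempty_modularParametrizationData`
(BCDT 2001) through the tree theorems `exists_isNewformOf_of_nonempty_modularParametrizationData` and
`IsNewformOf.level_eq_conductorNorm_of_exists_isNewformOf'`.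
[cite: BurungaleCastellaSkinner2025, Thm. 1.2.4 (b)] [cite: CastellaGrossiLeeSkinner2022, Thm. 5.1.3]
[cite: BCDTJAMS2001, Thm. A] [cite: Carayol1986] -/
theorem thm124b_thm513_of_printFacts_of_modularity
    (h124b : thm124b_exists_isBDPLFunction_isTorsion_charIdeal_eq)
    (h513 : thm513_exists_isBDPLFunction_valueAtOne_disc)
    (hpar : nonempty_modularParametrizationData) :
    thm124b_thm513_generator_constantCoeff :=
  thm124b_thm513_of_printFacts h124b h513
    fun _ _ ↦ IsNewformOf.level_eq_conductorNorm_of_exists_isNewformOf'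
      (exists_isNewformOf_of_nonempty_modularParametrizationData hpar)

end Summit.BirchSwinnertonDyer.Rank1Residual.X11b.YZComposite

end
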